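import Mathlib
import Literature.NumberTheory.LFunctions.Zhang2022.Section8AbelProfiles
import Literature.NumberTheory.LFunctions.Zhang2022.Section8Ded823Assembly
import Literature.NumberTheory.LFunctions.Zhang2022.Section8LambdaZeroGlobal
import Literature.NumberTheory.LFunctions.MontgomeryOffDiagonalTools
import Literature.NumberTheory.Sieve.CoprimeTotientLogSum
import HarnessLib

/-!
# Zhang (2022) §8 (8.11): the range-sum engine — `L′(1,χ)²·Σ_{n<X}|χ(n)|λ₀ⱼ(n)φ(n)⁻¹F(n) = 𝔞·∫₁^X F(t)dt/t + O(𝓛⁶(M + M′𝓛⁹))`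

Topic `Literature/NumberTheory/LFunctions/Zhang2022` (Landau–Siegel audit tree; verdict-neutral).
D-0069 campaign, cell `siegel-zhang`, DISCHARGE board row **D01** (`Skeleton.Ded823` chain; the
"partial integration" edge `Section8cStatements.Ded811`, [Z22 p.48, tex L2466]) and its analogues in
§9 ("in a way similar to the proof of (8.12)", p.51), §10 and §18. Seat sz-d29 (tool; the node
`Ded811` itself is held by seat d16). Y. Zhang, *Discrete mean estimates and the Landau–Siegel zero*,
arXiv:2211.02515v1 (2022) [Zhang2022LandauSiegel] — **an unrefereed manuscript under adjudication;
this file proves an elementary estimate about the manuscript's own typed objects and asserts nothing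
about its Theorems 1–2 or about Landau–Siegel zeros.** Theorem-only (no definitions, no new facts,
no numerics).

THE ENGINE (`weighted_sum_integral_eval`): for `D` large, `χ (mod D)` real primitive, `1 ≤ j ≤ 3`,
`2 ≤ X ≤ P`, and ANY profile `F : ℝ → ℂ` differentiable on `[1, X+1]` with `‖F‖ ≤ M` and
`‖F′(t)‖ ≤ M′/t` there,
`‖L′(1,χ)² Σ_{1≤n<X} |χ(n)|λ₀ⱼ(n)φ(n)⁻¹ F(n) − 𝔞 ∫₁^X F(t) dt/t‖ ≤ C(c′)·𝓛⁶·(M + M′𝓛⁹)`.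
With the profiles of (8.11) (`M ≍ 𝓛⁻¹⁸`, `M′ ≍ α𝓛⁻¹⁸`: `Section8AbelProfiles.mFac_bounds` etc.) the
right side is `O(𝓛⁻¹²) = o(α)`, which is the content of "it follows by partial integration that (8.11)".
Inputs, all kernel theorems: `λ₀ⱼ(n) = φ(n)²/n² + O(α𝓛)` (`Z22:§8.u047`,
`Section8cProofs.step8u047_holds`, seat d16); `Σ_{n≤x}1/φ(n) ≤ 7 + 12 log x`
(`Montgomery.sum_Icc_inv_totient_le`); `Σ_{n≤x}|χ(n)|φ(n)/n² = c_D log x + O(𝓛²)`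
(`Sieve.CoprimeTotient.abs_sum_norm_mul_totient_div_sq_sub_le` — the form of `Z22:§8.u048` that the
tree proves; the printed `O(log 𝓛)` is not needed); Abel summation
(`Section8AbelProfiles.norm_sum_mul_sub_integral_le`); `|L′(1,χ)| ≤ 4e^{9/2}𝓛²`
(`Lemma31.norm_deriv_LFunction_le_near_one`); `c_D·L′(1,χ)² = 𝔞` ((2.31), `Lemma171.frakAC_eq`).

| decl | content |
|---|---|
| `floor_natCast_sub_half`, `sum_Icc_zero_pred_eq` | index bookkeeping `⌊m − ½⌋ = m − 1`, `Σ_{Icc 0 (m−1)} = f 0 + Σ_{Ico 1 m}` |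
| `norm_weight_sub_le` | `‖|χ|λ₀ⱼ/φ·F − |χ|φ/n²·F‖ ≤ ‖λ₀ⱼ − φ²/n²‖·‖F‖/φ(n)` |
| `cD_mul_deriv_sq_eq_frakA`, `cD_bounds` | `c_D·L′(1,χ)² = 𝔞`, `0 ≤ c_D ≤ 1` |
| `weighted_sum_integral_eval` | the engine |

WHAT THIS FILE IS NOT: the discharge of `Ded811` (that is the §8 instance `F = mFac·nFac`,
`G = diagFac` plus the unfolding of `S811`; seat d16), nor any claim about Theorems 1–2.

## References

* Y. Zhang, arXiv:2211.02515v1 (2022), §8 p.48 (8.11), tex L2452–L2469; §2 (2.31).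
  [cite: Zhang2022LandauSiegel, §8 (8.11) p.48]
-/

noncomputable section

open Complex Real ComplexConjugate Set MeasureTheory Finset

namespace Literature.NumberTheory.LFunctions.Zhang2022.Section8RangeEngine

open Skeleton Section8cStatements Section8AbelProfiles

/-! ### Small index facts -/

/-- For an integer `m ≥ 1`: `⌊m − 1/2⌋ = m − 1`. [cite: Zhang2022LandauSiegel, §8 (8.11) p.48] -/
theorem floor_natCast_sub_half {m : ℕ} (hm : 1 ≤ m) : ⌊((m : ℝ) - 1 / 2)⌋₊ = m - 1 := by
  have hm' : ((m - 1 : ℕ) : ℝ) = (m : ℝ) - 1 := by rw [Nat.cast_sub hm, Nat.cast_one]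
  have h1 : (1 : ℝ) ≤ m := by exact_mod_cast hm
  rw [Nat.floor_eq_iff (by linarith), hm']
  constructor <;> linarith

/-- `Σ_{k ∈ Icc 0 (m−1)} f k = f 0 + Σ_{k ∈ Ico 1 m} f k` (`m ≥ 1`). [cite: Zhang2022LandauSiegel, §8 (8.11) p.48] -/
theorem sum_Icc_zero_pred_eq {M : Type*} [AddCommMonoid M] (f : ℕ → M) {m : ℕ} (hm : 1 ≤ m) :
    ∑ k ∈ Finset.Icc 0 (m - 1), f k = f 0 + ∑ k ∈ Finset.Ico 1 m, f k := by
  have e : Finset.Icc 0 (m - 1) = Finset.Ico 0 m := by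
    ext k; simp only [Finset.mem_Icc, Finset.mem_Ico]; omega
  rw [e, Finset.sum_eq_sum_Ico_succ_bot (by omega) f]

/-! ### The weights: `|χ(n)|λ₀ⱼ(n)/φ(n)` versus `|χ(n)|φ(n)/n²` -/

/-- `|χ(n)|λ₀ⱼ(n)/φ(n)·F − |χ(n)|φ(n)/n²·F = |χ(n)|φ(n)⁻¹(λ₀ⱼ(n) − φ(n)²/n²)·F` (`n ≥ 1`), so its norm
is at most `‖λ₀ⱼ(n) − φ(n)²/n²‖·‖F‖/φ(n)`. [cite: Zhang2022LandauSiegel, §8 display before (8.11) p.48, tex L2459] -/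
theorem norm_weight_sub_le {D : ℕ} [NeZero D] (χ : DirichletCharacter ℂ D) (lam F : ℂ) {n : ℕ}
    (hn : 1 ≤ n) :
    ‖(‖χ (n : ZMod D)‖ : ℂ) * lam / (Nat.totient n : ℂ) * F -
        ((‖χ (n : ZMod D)‖ * ((Nat.totient n : ℝ) / (n : ℝ) ^ 2) : ℝ) : ℂ) * F‖ ≤
      ‖lam - ((Nat.totient n : ℂ) / (n : ℂ)) ^ 2‖ * ‖F‖ / (Nat.totient n : ℝ) := by
  have hφ : 0 < (Nat.totient n : ℝ) := by exact_mod_cast Nat.totient_pos.mpr (by omega)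
  have hφC : (Nat.totient n : ℂ) ≠ 0 := by exact_mod_cast hφ.ne'
  have hnC : (n : ℂ) ≠ 0 := by exact_mod_cast (by omega : n ≠ 0)
  have e : (‖χ (n : ZMod D)‖ : ℂ) * lam / (Nat.totient n : ℂ) * F -
        ((‖χ (n : ZMod D)‖ * ((Nat.totient n : ℝ) / (n : ℝ) ^ 2) : ℝ) : ℂ) * F =
      (‖χ (n : ZMod D)‖ : ℂ) / (Nat.totient n : ℂ) * (lam - ((Nat.totient n : ℂ) / (n : ℂ)) ^ 2) * F := by
    push_cast
    field_simp
  rw [e, norm_mul, norm_mul, norm_div, Complex.norm_real, Complex.norm_natCast, norm_norm]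
  have hχ : ‖χ (n : ZMod D)‖ ≤ 1 := χ.norm_le_one _
  calc ‖χ (n : ZMod D)‖ / (Nat.totient n : ℝ) * ‖lam - ((Nat.totient n : ℂ) / (n : ℂ)) ^ 2‖ * ‖F‖
      ≤ 1 / (Nat.totient n : ℝ) * ‖lam - ((Nat.totient n : ℂ) / (n : ℂ)) ^ 2‖ * ‖F‖ := by gcongr
    _ = ‖lam - ((Nat.totient n : ℂ) / (n : ℂ)) ^ 2‖ * ‖F‖ / (Nat.totient n : ℝ) := by ring

/-! ### `𝔞 = c_D · L′(1,χ)²` -/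

/-- `(6/π²)∏_{q∣D}q/(q+1) · L′(1,χ)² = 𝔞` as complex numbers, for a quadratic primitive `χ` (`L′(1,χ)`
is real: `Lemma171.frakAC_eq`). [cite: Zhang2022LandauSiegel, §2 (2.31)] -/
theorem cD_mul_deriv_sq_eq_frakA {D : ℕ} [NeZero D] (χ : DirichletCharacter ℂ D) (hD : 2 ≤ D)
    (hq : χ.IsQuadratic) (hp : χ.IsPrimitive) :
    ((Literature.NumberTheory.Sieve.CoprimeTotient.totientLogDensity D : ℝ) : ℂ) *
        deriv χ.LFunction 1 ^ 2 = (frakA χ : ℂ) := by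
  have hχ1 : χ ≠ 1 := Lemma31.ne_one_of_isPrimitive χ hD hp
  have h := Lemma171.frakAC_eq χ hχ1 hq.sq_eq_one
  rw [Skeleton.frakA, ← h, Lemma171.frakAC,
    Literature.NumberTheory.Sieve.CoprimeTotient.totientLogDensity_def]
  push_cast
  ring

/-- `c_D = (6/π²)∏_{q∣D}q/(q+1) ∈ [0, 1]`. [cite: Zhang2022LandauSiegel, §2 (2.31)] -/
theorem cD_bounds (D : ℕ) :
    0 ≤ Literature.NumberTheory.Sieve.CoprimeTotient.totientLogDensity D ∧
      Literature.NumberTheory.Sieve.CoprimeTotient.totientLogDensity D ≤ 1 := by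
  rw [Literature.NumberTheory.Sieve.CoprimeTotient.totientLogDensity_def]
  have hprod0 : 0 ≤ ∏ p ∈ D.primeFactors, ((p : ℝ) / (p + 1)) :=
    Finset.prod_nonneg fun p _ => by positivity
  have hprod : ∏ p ∈ D.primeFactors, ((p : ℝ) / (p + 1)) ≤ 1 :=
    Finset.prod_le_one (fun p _ => by positivity)
      (fun p _ => by rw [div_le_one (by positivity)]; linarith)
  have hπ : 6 / π ^ 2 ≤ 1 := by
    rw [div_le_one (by positivity)]
    nlinarith [Real.pi_gt_three]
  refine ⟨by positivity, ?_⟩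
  calc 6 / π ^ 2 * ∏ p ∈ D.primeFactors, ((p : ℝ) / (p + 1)) ≤ 1 * 1 :=
        mul_le_mul hπ hprod hprod0 (by norm_num)
    _ = 1 := by norm_num

/-! ### The engine -/

/-- **The range-sum engine of (8.11)** (and of its §9/§10/§18 analogues). For every `C¹` profile
`F` on `[1, X+1]` with `‖F‖ ≤ M`, `‖F′(t)‖ ≤ M′/t` (`2 ≤ X ≤ P`), and every `j ∈ {1,2,3}`:
`‖L′(1,χ)² Σ_{n<X} |χ(n)|λ₀ⱼ(n)φ(n)⁻¹ F(n) − 𝔞 ∫₁^X F(t)dt/t‖ ≤ C·𝓛⁶(M + M′𝓛⁹)`, for all large `D`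
and every real primitive `χ (mod D)`, with `C` depending on `c′` only. Ingredients: `λ₀ⱼ(n) = φ(n)²/n²
+ O(α𝓛)` (`Z22:§8.u047`, `Section8cProofs.step8u047_holds`, d16) + `Σ_{n≤x}1/φ(n) ≤ 7 + 12 log x`
(tree, `Montgomery.sum_Icc_inv_totient_le`); the twisted totient mean value
`Σ_{n≤x}|χ(n)|φ(n)/n² = c_D log x + O(𝓛²)` (`Z22:§8.u048` in the form the tree proves,
`Sieve.CoprimeTotient.abs_sum_norm_mul_totient_div_sq_sub_le`); Abel summation
(`Section8AbelProfiles.norm_sum_mul_sub_integral_le`); `|L′(1,χ)| ≤ 4e^{9/2}𝓛²`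
(`Lemma31.norm_deriv_LFunction_le_near_one`); `c_D·L′(1,χ)² = 𝔞` ((2.31)). This is the manuscript's
"it follows by partial integration that" [Z22 p.48, tex L2466], made quantitative.
[cite: Zhang2022LandauSiegel, §8 (8.11) p.48, tex L2452–L2469] -/
theorem weighted_sum_integral_eval (c' : ℝ) :
    ∃ C : ℝ, ForAllLarge fun D _ χ => ∀ j ∈ ({1, 2, 3} : Finset ℕ),
      ∀ (X M M' : ℝ) (F : ℝ → ℂ), 2 ≤ X → X ≤ bigP D → 0 ≤ M → 0 ≤ M' →
        (∀ t ∈ Set.Icc 1 (X + 1), DifferentiableAt ℝ F t) →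
        (∀ t ∈ Set.Icc 1 (X + 1), ‖F t‖ ≤ M) →
        (∀ t ∈ Set.Icc 1 (X + 1), ‖deriv F t‖ ≤ M' / t) →
        ‖deriv χ.LFunction 1 ^ 2 *
              (∑ n ∈ Finset.Ico 1 ⌈X⌉₊,
                (‖χ (n : ZMod D)‖ : ℂ) * lamZero c' D j n / (Nat.totient n : ℂ) * F n) -
            (frakA χ : ℂ) * ∫ t in (1 : ℝ)..X, F t / t‖ ≤
          C * ell D ^ 6 * (M + M' * ell D ^ 9) := by
  obtain ⟨C₇, h47⟩ := Section8cProofs.step8u047_holds c'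
  set Q₁ : ℝ := 19 * π * |C₇| + 26 with hQ₁
  set Q₂ : ℝ := 48 with hQ₂
  have hQ₁0 : 0 ≤ Q₁ := by positivity
  refine ⟨16 * Real.exp 9 * (Q₁ + Q₂), ?_⟩
  have FL : ForAllLarge fun D _ _ => 3 ≤ ell D :=
    ForAllLarge.of_le 21 fun D _ _ hD _ _ => Section8Ded823.three_le_ell hD
  refine (h47.and FL).mono ?_
  intro D _ χ hq hp h j hj X M M' F hX2 hXP hM hM' hFd hF hF'
  obtain ⟨e47, hℓ3⟩ := h
  -- parameters
  have hℓ1 : 1 ≤ ell D := by linarith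
  have hℓ0 : 0 < ell D := by linarith
  -- small numeric facts about `𝓛` (proved while the context is still small)
  have hK : 3 * (1 + ell D) ^ 2 + 11 ≤ 24 * ell D ^ 2 := by nlinarith
  have h2ℓ : ell D ≤ ell D ^ 2 := by nlinarith
  have h3ℓ : (1 : ℝ) ≤ ell D ^ 2 := one_le_pow₀ hℓ1
  have h19 : (7 + 12 * ell D ^ 9) / ell D ^ 8 ≤ 19 * ell D := by
    rw [div_le_iff₀ (by positivity)]
    have h8 : (1 : ℝ) ≤ ell D ^ 8 := one_le_pow₀ hℓ1
    nlinarith [h8, hℓ1]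
  have hlogD : 3 ≤ Real.log D := hℓ3
  have hD2 : 2 ≤ D := by
    by_contra hlt
    have : (D : ℝ) ≤ 1 := by exact_mod_cast (by omega : D ≤ 1)
    have : Real.log D ≤ 0 := Real.log_nonpos (by positivity) this
    linarith
  have hD0 : D ≠ 0 := by omega
  have hα : alpha D = π / ell D ^ 9 := by rw [Skeleton.alpha, log_bigP]
  have hαℓ : alpha D * ell D = π / ell D ^ 8 := by
    rw [hα]; field_simp
  have hlogP : Real.log (bigP D) = ell D ^ 9 := by rw [Skeleton.bigP, Real.log_exp]
  have hα0 : 0 < alpha D := by rw [hα]; positivity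
  have hlogX : Real.log X ≤ ell D ^ 9 := by
    rw [← hlogP]; exact Real.log_le_log (by linarith) hXP
  -- `‖L′(1,χ)²‖ ≤ 16e⁹𝓛⁴`
  have hL' : ‖deriv χ.LFunction 1 ^ 2‖ ≤ 16 * Real.exp 9 * ell D ^ 4 := by
    have h := Lemma31.norm_deriv_LFunction_le_near_one χ hlogD hp (w := 1) (by simp; positivity)
    rw [show Real.log D = ell D from rfl] at h
    have h2 : ‖deriv χ.LFunction 1‖ ≤ 4 * Real.exp (9 / 2) * ell D ^ 2 := by
      refine h.trans ?_
      have he : 0 ≤ Real.exp (9 / 2) := (Real.exp_pos _).le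
      nlinarith [mul_nonneg he hℓ0.le]
    have he9 : Real.exp (9 / 2) ^ 2 = Real.exp 9 := by rw [← Real.exp_nat_mul]; norm_num
    rw [norm_pow]
    calc ‖deriv χ.LFunction 1‖ ^ 2 ≤ (4 * Real.exp (9 / 2) * ell D ^ 2) ^ 2 :=
          pow_le_pow_left₀ (norm_nonneg _) h2 2
      _ = 16 * Real.exp 9 * ell D ^ 4 := by rw [mul_pow, mul_pow, he9]; ring
  -- the ceiling `N = ⌈X⌉` and the Abel endpoint `X' = N − 1/2`
  set N : ℕ := ⌈X⌉₊ with hN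
  have hXN : X ≤ N := Nat.le_ceil X
  have hN1X : (N : ℝ) - 1 < X := by
    have := Nat.ceil_lt_add_one (by linarith : (0 : ℝ) ≤ X); rw [← hN] at this; linarith
  have hN2 : 2 ≤ N := by
    have : (2 : ℝ) ≤ N := hX2.trans hXN
    exact_mod_cast this
  have hN1 : 1 ≤ N := by omega
  set X' : ℝ := (N : ℝ) - 1 / 2 with hX'
  have hX'1 : 1 ≤ X' := by
    have : (2 : ℝ) ≤ N := by exact_mod_cast hN2
    rw [hX']; linarith
  have hX'X : X' ≤ X + 1 / 2 := by rw [hX']; linarith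
  have hXX' : X - 1 / 2 ≤ X' := by rw [hX']; linarith
  have hfloor : ⌊X'⌋₊ = N - 1 := floor_natCast_sub_half hN1
  have hlogX' : Real.log X' ≤ 2 * ell D ^ 9 := by
    have h1 : X' ≤ 2 * X := by linarith
    have h2 : Real.log X' ≤ Real.log (2 * X) := Real.log_le_log (by linarith) h1
    rw [Real.log_mul (by norm_num) (by linarith)] at h2
    have h3 : Real.log 2 ≤ 1 := by
      have := Real.log_two_lt_d9; linarith
    have h4 : (1 : ℝ) ≤ ell D ^ 9 := one_le_pow₀ hℓ1
    linarith
  -- the weights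
  set w : ℕ → ℂ := fun n => (‖χ (n : ZMod D)‖ : ℂ) * lamZero c' D j n / (Nat.totient n : ℂ) with hw
  set b : ℕ → ℝ := fun n => ‖χ (n : ZMod D)‖ * ((Nat.totient n : ℝ) / (n : ℝ) ^ 2) with hb
  have hb0 : b 0 = 0 := by simp [hb]
  set cD : ℝ := Literature.NumberTheory.Sieve.CoprimeTotient.totientLogDensity D with hcD
  obtain ⟨hcD0, hcD1⟩ := cD_bounds D
  have hFcont : ContinuousOn F (Set.Icc 1 (X + 1)) :=
    fun t ht => (hFd t ht).continuousAt.continuousWithinAt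
  -- (E1) replacing `λ₀ⱼ(n)/φ(n)` by `φ(n)/n²`
  have E1 : ‖(∑ n ∈ Finset.Ico 1 N, w n * F n) - ∑ n ∈ Finset.Ico 1 N, (b n : ℂ) * F n‖ ≤
      19 * π * |C₇| * ell D * M := by
    rw [← Finset.sum_sub_distrib]
    have hterm : ∀ n ∈ Finset.Ico 1 N, ‖w n * F n - (b n : ℂ) * F n‖ ≤
        |C₇| * (alpha D * ell D) * M * (1 / (Nat.totient n : ℝ)) := by
      intro n hn
      rw [Finset.mem_Ico] at hn
      have hn1 : 1 ≤ n := hn.1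
      have hnX : (n : ℝ) < X := by
        have : (n : ℝ) ≤ (N : ℝ) - 1 := by
          have : n ≤ N - 1 := by omega
          have := (Nat.cast_le (α := ℝ)).mpr this
          rw [Nat.cast_sub hN1] at this; simpa using this
        linarith
      have hnP : (n : ℝ) < bigP D := lt_of_lt_of_le hnX hXP
      have hφ : 0 < (Nat.totient n : ℝ) := by exact_mod_cast Nat.totient_pos.mpr (by omega)
      have hlam := e47 j hj n hn1 hnP
      have hlam' : ‖lamZero c' D j n - ((Nat.totient n : ℂ) / (n : ℂ)) ^ 2‖ ≤ |C₇| * (alpha D * ell D) :=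
        hlam.trans (mul_le_mul_of_nonneg_right (le_abs_self _) (mul_nonneg hα0.le hℓ0.le))
      have hFn : ‖F n‖ ≤ M := hF n ⟨by exact_mod_cast hn1, by linarith⟩
      have key := norm_weight_sub_le χ (lamZero c' D j n) (F n) hn1
      have h2 : ‖lamZero c' D j n - ((Nat.totient n : ℂ) / (n : ℂ)) ^ 2‖ * ‖F n‖ ≤
          (|C₇| * (alpha D * ell D)) * M :=
        mul_le_mul hlam' hFn (norm_nonneg _)
          (mul_nonneg (abs_nonneg _) (mul_nonneg hα0.le hℓ0.le))
      refine key.trans ?_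
      rw [div_eq_mul_one_div]
      exact mul_le_mul_of_nonneg_right h2 (by positivity)
    refine (norm_sum_le _ _).trans ((Finset.sum_le_sum hterm).trans ?_)
    rw [← Finset.mul_sum]
    have hsum : ∑ n ∈ Finset.Ico 1 N, 1 / (Nat.totient n : ℝ) ≤ 7 + 12 * ell D ^ 9 := by
      have e : Finset.Ico 1 N = Finset.Icc 1 (N - 1) := by
        ext n; simp only [Finset.mem_Ico, Finset.mem_Icc]; omega
      rw [e]
      refine (Literature.NumberTheory.LFunctions.Montgomery.sum_Icc_inv_totient_le (N - 1)).trans ?_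
      have hN1R : (1 : ℝ) ≤ ((N - 1 : ℕ) : ℝ) := by exact_mod_cast (by omega : 1 ≤ N - 1)
      have hlogN : Real.log ((N - 1 : ℕ) : ℝ) ≤ ell D ^ 9 := by
        refine le_trans (Real.log_le_log (by linarith) ?_) hlogX
        rw [Nat.cast_sub hN1]; push_cast; linarith
      linarith
    have h0 : 0 ≤ |C₇| * (alpha D * ell D) * M :=
      mul_nonneg (mul_nonneg (abs_nonneg _) (mul_nonneg hα0.le hℓ0.le)) hM
    calc |C₇| * (alpha D * ell D) * M * ∑ n ∈ Finset.Ico 1 N, 1 / (Nat.totient n : ℝ)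
        ≤ |C₇| * (alpha D * ell D) * M * (7 + 12 * ell D ^ 9) := mul_le_mul_of_nonneg_left hsum h0
      _ = |C₇| * M * (π * ((7 + 12 * ell D ^ 9) / ell D ^ 8)) := by rw [hαℓ]; ring
      _ ≤ |C₇| * M * (π * (19 * ell D)) :=
          mul_le_mul_of_nonneg_left (mul_le_mul_of_nonneg_left h19 Real.pi_pos.le) (by positivity)
      _ = 19 * π * |C₇| * ell D * M := by ring
  -- (E2) Abel summation on `[1, X']`
  have hR : ∀ t ∈ Set.Icc 1 X', |(∑ k ∈ Finset.Icc 0 ⌊t⌋₊, b k) - cD * Real.log t| ≤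
      3 * (1 + ell D) ^ 2 + 11 := by
    intro t ht
    have hsub : ∑ k ∈ Finset.Icc 0 ⌊t⌋₊, b k = ∑ k ∈ Finset.Icc 1 ⌊t⌋₊, b k := by
      refine (Finset.sum_subset (fun k hk => ?_) (fun k hk hk' => ?_)).symm
      · rw [Finset.mem_Icc] at hk ⊢; omega
      · rw [Finset.mem_Icc] at hk hk'
        have : k = 0 := by omega
        rw [this, hb0]
    rw [hsub]
    have h := Literature.NumberTheory.Sieve.CoprimeTotient.abs_sum_norm_mul_totient_div_sq_sub_le
      hD0 χ ht.1
    exact h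
  have E2 : ‖(∑ k ∈ Finset.Icc 0 ⌊X'⌋₊, F k * (b k : ℂ)) - cD * ∫ t in (1 : ℝ)..X', F t / t‖ ≤
      (3 * (1 + ell D) ^ 2 + 11) * M + (3 * (1 + ell D) ^ 2 + 11) * M' * Real.log X' :=
    norm_sum_mul_sub_integral_le hb0 hX'1 hM' hR
      (fun t ht => hFd t ⟨ht.1, by linarith [ht.2]⟩) (fun t ht => hF t ⟨ht.1, by linarith [ht.2]⟩)
      (fun t ht => hF' t ⟨ht.1, by linarith [ht.2]⟩)
  have hreindex : (∑ k ∈ Finset.Icc 0 ⌊X'⌋₊, F k * (b k : ℂ)) = ∑ n ∈ Finset.Ico 1 N, (b n : ℂ) * F n := by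
    rw [hfloor, sum_Icc_zero_pred_eq _ hN1, hb0]
    push_cast
    rw [mul_zero, zero_add]
    exact Finset.sum_congr rfl fun n _ => mul_comm _ _
  -- (E3) the endpoint adjustment `∫₁^{X'} → ∫₁^X`
  have hIntF : ∀ a b : ℝ, 1 ≤ a → a ≤ X + 1 → 1 ≤ b → b ≤ X + 1 →
      IntervalIntegrable (fun t : ℝ => F t / (t : ℂ)) volume a b := by
    intro a b ha1 haX hb1 hbX
    refine ((hFcont.div Complex.continuous_ofReal.continuousOn ?_).mono ?_).intervalIntegrable
    · intro t ht; exact_mod_cast (by linarith [ht.1] : t ≠ 0)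
    · intro t ht
      rcases Set.mem_uIcc.mp ht with ⟨h1, h2⟩ | ⟨h1, h2⟩
      · exact ⟨le_trans ha1 h1, le_trans h2 hbX⟩
      · exact ⟨le_trans hb1 h1, le_trans h2 haX⟩
  have E3 : ‖(cD : ℂ) * (∫ t in (1 : ℝ)..X', F t / t) - (cD : ℂ) * (∫ t in (1 : ℝ)..X, F t / t)‖ ≤
      M / 2 := by
    rw [← mul_sub, intervalIntegral.integral_interval_sub_left
      (hIntF 1 X' le_rfl (by linarith) hX'1 (by linarith))
      (hIntF 1 X le_rfl (by linarith) (by linarith) (by linarith)),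
      norm_mul, Complex.norm_real, Real.norm_eq_abs, abs_of_nonneg hcD0]
    have hI : ‖∫ t in X..X', F t / t‖ ≤ M * |X' - X| := by
      refine intervalIntegral.norm_integral_le_of_norm_le_const fun t ht => ?_
      rw [Set.uIoc, Set.mem_Ioc] at ht
      have ht1 : 1 ≤ t := by
        have := ht.1; rw [lt_iff_le_and_ne] at this
        have hmin : X - 1 / 2 ≤ min X X' := le_min (by linarith) hXX'
        linarith [hmin, ht.1.le, min_le_left X X']
      have htX : t ≤ X + 1 := le_trans ht.2 ((max_le (by linarith) hX'X).trans (by linarith))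
      have ht0 : 0 < t := by linarith
      rw [norm_div, Complex.norm_real, Real.norm_eq_abs, abs_of_pos ht0]
      exact (div_le_div_of_nonneg_right (hF t ⟨ht1, htX⟩) ht0.le |>.trans (div_le_self hM ht1))
    have habs : |X' - X| ≤ 1 / 2 := by rw [abs_le]; constructor <;> linarith
    calc cD * ‖∫ t in X..X', F t / t‖ ≤ 1 * (M * (1 / 2)) :=
          mul_le_mul hcD1 (hI.trans (mul_le_mul_of_nonneg_left habs hM)) (norm_nonneg _) zero_le_one
      _ = M / 2 := by ring
  -- (E4) assemble: `L′²·T − 𝔞·I = L′²[(T − B) + (B − c I') + c(I' − I)]`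
  have hfrakA : (frakA χ : ℂ) = (cD : ℂ) * deriv χ.LFunction 1 ^ 2 := by
    rw [hcD, cD_mul_deriv_sq_eq_frakA χ hD2 hq hp]
  set T : ℂ := ∑ n ∈ Finset.Ico 1 N, w n * F n with hT
  set B : ℂ := ∑ n ∈ Finset.Ico 1 N, (b n : ℂ) * F n with hB
  set I : ℂ := ∫ t in (1 : ℝ)..X, F t / t with hI
  set I' : ℂ := ∫ t in (1 : ℝ)..X', F t / t with hI'
  set L2 : ℂ := deriv χ.LFunction 1 ^ 2 with hL2
  rw [hfrakA]
  have key : L2 * T - (cD : ℂ) * L2 * I =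
      L2 * ((T - B) + (B - (cD : ℂ) * I') + ((cD : ℂ) * I' - (cD : ℂ) * I)) := by ring
  rw [key, norm_mul]
  have inner : ‖(T - B) + (B - (cD : ℂ) * I') + ((cD : ℂ) * I' - (cD : ℂ) * I)‖ ≤
      Q₁ * ell D ^ 2 * M + Q₂ * ell D ^ 11 * M' := by
    have e2' : ‖B - (cD : ℂ) * I'‖ ≤ 24 * ell D ^ 2 * M + 24 * ell D ^ 2 * M' * (2 * ell D ^ 9) := by
      rw [← hreindex]
      refine E2.trans ?_
      have hK0 : 0 ≤ 3 * (1 + ell D) ^ 2 + 11 := by positivity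
      have hlX0 : 0 ≤ Real.log X' := Real.log_nonneg hX'1
      have a1 : (3 * (1 + ell D) ^ 2 + 11) * M ≤ 24 * ell D ^ 2 * M :=
        mul_le_mul_of_nonneg_right hK hM
      have a2 : (3 * (1 + ell D) ^ 2 + 11) * M' * Real.log X' ≤
          24 * ell D ^ 2 * M' * (2 * ell D ^ 9) :=
        mul_le_mul (mul_le_mul_of_nonneg_right hK hM') hlogX' hlX0 (by positivity)
      linarith only [a1, a2]
    calc ‖(T - B) + (B - (cD : ℂ) * I') + ((cD : ℂ) * I' - (cD : ℂ) * I)‖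
        ≤ ‖T - B‖ + ‖B - (cD : ℂ) * I'‖ + ‖(cD : ℂ) * I' - (cD : ℂ) * I‖ := norm_add₃_le
      _ ≤ 19 * π * |C₇| * ell D * M + (24 * ell D ^ 2 * M + 24 * ell D ^ 2 * M' * (2 * ell D ^ 9)) +
            M / 2 := add_le_add (add_le_add E1 e2') E3
      _ ≤ Q₁ * ell D ^ 2 * M + Q₂ * ell D ^ 11 * M' := by
          rw [hQ₁, hQ₂]
          have hπ0 : 0 ≤ 19 * π * |C₇| * M := by positivity
          have t1 : 19 * π * |C₇| * ell D * M ≤ 19 * π * |C₇| * ell D ^ 2 * M := by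
            have := mul_le_mul_of_nonneg_left h2ℓ hπ0
            linarith only [this]
          have t2 : M / 2 ≤ 2 * ell D ^ 2 * M := by
            have := mul_le_mul_of_nonneg_right h3ℓ hM
            linarith only [this, hM]
          have t3 : 24 * ell D ^ 2 * M' * (2 * ell D ^ 9) = 48 * ell D ^ 11 * M' := by ring
          have e : (19 * π * |C₇| + 26) * ell D ^ 2 * M + 48 * ell D ^ 11 * M' =
              19 * π * |C₇| * ell D ^ 2 * M + 24 * ell D ^ 2 * M + 2 * ell D ^ 2 * M +
                48 * ell D ^ 11 * M' := by ring
          rw [e, t3]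
          linarith only [t1, t2]
  have hQ₂0 : 0 ≤ Q₂ := by rw [hQ₂]; norm_num
  have h6M : 0 ≤ ell D ^ 6 * M := mul_nonneg (pow_nonneg hℓ0.le 6) hM
  have h6M' : 0 ≤ ell D ^ 6 * (M' * ell D ^ 9) :=
    mul_nonneg (pow_nonneg hℓ0.le 6) (mul_nonneg hM' (pow_nonneg hℓ0.le 9))
  have u1 : Q₁ * (ell D ^ 6 * M) ≤ (Q₁ + Q₂) * (ell D ^ 6 * M) :=
    mul_le_mul_of_nonneg_right (by linarith) h6M
  have u2 : Q₂ * (ell D ^ 6 * (M' * ell D ^ 9)) ≤ (Q₁ + Q₂) * (ell D ^ 6 * (M' * ell D ^ 9)) :=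
    mul_le_mul_of_nonneg_right (by linarith) h6M'
  have he0 : 0 ≤ 16 * Real.exp 9 := by positivity
  calc ‖L2‖ * ‖(T - B) + (B - (cD : ℂ) * I') + ((cD : ℂ) * I' - (cD : ℂ) * I)‖
      ≤ (16 * Real.exp 9 * ell D ^ 4) * (Q₁ * ell D ^ 2 * M + Q₂ * ell D ^ 11 * M') :=
        mul_le_mul hL' inner (norm_nonneg _)
          (mul_nonneg (mul_nonneg (by norm_num) (Real.exp_pos _).le) (pow_nonneg hℓ0.le 4))
    _ = 16 * Real.exp 9 * (Q₁ * (ell D ^ 6 * M) + Q₂ * (ell D ^ 6 * (M' * ell D ^ 9))) := by ring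
    _ ≤ 16 * Real.exp 9 * ((Q₁ + Q₂) * (ell D ^ 6 * M) + (Q₁ + Q₂) * (ell D ^ 6 * (M' * ell D ^ 9))) :=
        mul_le_mul_of_nonneg_left (add_le_add u1 u2) he0
    _ = 16 * Real.exp 9 * (Q₁ + Q₂) * ell D ^ 6 * (M + M' * ell D ^ 9) := by ring

end Literature.NumberTheory.LFunctions.Zhang2022.Section8RangeEngine
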